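import Literature.MathematicalPhysics.QuantumFieldTheory.OSReconstructionNoE1
import Summits.QuantumFields.YangMills.Theorems.LangevinControlUVOSLegsAtWeakCouplingCDefs
import Literature.MathematicalPhysics.QuantumLattice.SchwartzTranslationCutoff
import HarnessLib

/-!
# Product bumps and the two-cluster identity (E1-locality toolkit III)

Helper file for stub `stub_locality` of crux `OSLegsAtWeakCouplingC` (stmt-QuantumFields-16207, line `Sketch`).
The analytic-continuation argument of the lead's locality proof evaluates the one-field family `S₁` on PRODUCT BUMPS
`⊗ᵢ ρ(· − cᵢ)` (one radial real profile `ρ` of small support translated to the points of a configuration `c`); this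
file is their calculus:

* `prodBumps ρ n c` (`= SchwartzMap.tensorFin n (i ↦ compSubConstCLM ℂ (c i) ρ)`), `prodBumps_apply`, continuity in the
  centres, support, off-diagonality for separated centres, behaviour under diagonal translations, linear isometries
  leaving `ρ` invariant, and permutations of the points;
* `isTimeOrdered_prodBumps` — time-ordering from time-sorted, time-separated centres;
* `osAdjoint_prodBumps_appendTensor` — **the two-cluster identity**: for a `θ`-invariant real profile,
  `Θ(⊗ⱼ ρ(· − θ c_L(rev j)))* ⊗ T_{t e₀}(⊗ⱼ ρ(· − c_U j)) = ⊗ (ρ(· − c))` over the appended configuration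
  `(c_L, c_U + t e₀)`;
* `bumpFn S₁ ρ n c := S₁ n (prodBumps ρ n c)` and its invariances (translation, signed permutations / isometries, E3).
-/

noncomputable section

open MeasureTheory Set Filter Complex
open _root_.Topology
open scoped InnerProductSpace ComplexConjugate SchwartzMap BigOperators
open Literature.MathematicalPhysics.QuantumFieldTheory Literature.MathematicalPhysics.QuantumLattice
open Literature.MathematicalPhysics.AQFT
open Literature.MathematicalPhysics.QuantumLattice.SchwingerFamily (timeVec)

namespace Summit.QuantumFields.YangMills.Theorems.OSLegsAtWeakCouplingC

variable {n : ℕ}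

/-! ### Product bumps -/

/-- **Product bump**: the `n`-point test function `x ↦ ∏ᵢ ρ (xᵢ − cᵢ)`. -/
def prodBumps (ρ : 𝓢(EuclideanSpace ℝ (Fin 4), ℂ)) (n : ℕ) (c : Fin n → EuclideanSpace ℝ (Fin 4)) :
    𝓢((Fin n → EuclideanSpace ℝ (Fin 4)), ℂ) :=
  SchwartzMap.tensorFin n (fun i => SchwartzMap.compSubConstCLM ℂ (c i) ρ)

variable (ρ : 𝓢(EuclideanSpace ℝ (Fin 4), ℂ))

/-- Pointwise formula. -/
@[simp] theorem prodBumps_apply (c x : Fin n → EuclideanSpace ℝ (Fin 4)) :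
    prodBumps ρ n c x = ∏ i, ρ (x i - c i) := by
  simp [prodBumps, SchwartzMap.tensorFin_apply, SchwartzMap.compSubConstCLM_apply]

/-- Product bumps are translates (in the product space) of the product bump centred at `0`. -/
theorem prodBumps_eq_compSubConstCLM (c : Fin n → EuclideanSpace ℝ (Fin 4)) :
    prodBumps ρ n c = SchwartzMap.compSubConstCLM ℂ c (prodBumps ρ n 0) := by
  ext x
  simp [SchwartzMap.compSubConstCLM_apply, Pi.sub_apply]

/-- The centres enter continuously (strong continuity of translations on Schwartz space). -/
theorem continuous_prodBumps : Continuous fun c : Fin n → EuclideanSpace ℝ (Fin 4) => prodBumps ρ n c := by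
  have h : (fun c : Fin n → EuclideanSpace ℝ (Fin 4) => prodBumps ρ n c) =
      fun c => SchwartzMap.compSubConstCLM ℂ c (prodBumps ρ n 0) := funext fun c => prodBumps_eq_compSubConstCLM ρ c
  rw [h]
  exact continuous_compSubConstCLM ℂ (prodBumps ρ n 0)

/-- Support of a product bump: every point lies in the support ball of its profile. -/
theorem tsupport_prodBumps_subset {r : ℝ} (hρ : tsupport (ρ : EuclideanSpace ℝ (Fin 4) → ℂ) ⊆ Metric.closedBall 0 r)
    (c : Fin n → EuclideanSpace ℝ (Fin 4)) :
    tsupport (prodBumps ρ n c : (Fin n → EuclideanSpace ℝ (Fin 4)) → ℂ) ⊆ {x | ∀ i, x i ∈ Metric.closedBall (c i) r} := by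
  have hcl : IsClosed {x : Fin n → EuclideanSpace ℝ (Fin 4) | ∀ i, x i ∈ Metric.closedBall (c i) r} := by
    simp only [Set.setOf_forall]
    exact isClosed_iInter fun i => Metric.isClosed_closedBall.preimage (continuous_apply i)
  refine closure_minimal (fun x hx => ?_) hcl
  simp only [Function.mem_support, prodBumps_apply] at hx
  intro i
  have hi : ρ (x i - c i) ≠ 0 := fun h0 => hx (Finset.prod_eq_zero (Finset.mem_univ i) h0)
  have hmem : x i - c i ∈ tsupport (ρ : EuclideanSpace ℝ (Fin 4) → ℂ) := subset_closure hi
  have := hρ hmem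
  rw [Metric.mem_closedBall, dist_eq_norm, sub_zero] at this
  rwa [Metric.mem_closedBall, dist_eq_norm]

/-- Centres pairwise more than `2r` apart. -/
def SepCenters (r : ℝ) (c : Fin n → EuclideanSpace ℝ (Fin 4)) : Prop := ∀ i j, i ≠ j → 2 * r < dist (c i) (c j)

/-- **Product bumps with separated centres are off-diagonal** (they vanish near the coincidence locus). -/
theorem isOffDiagonal_prodBumps {r : ℝ} (hρ : tsupport (ρ : EuclideanSpace ℝ (Fin 4) → ℂ) ⊆ Metric.closedBall 0 r)
    {c : Fin n → EuclideanSpace ℝ (Fin 4)} (hc : SepCenters r c) : IsOffDiagonal (prodBumps ρ n c) := by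
  intro x hx k
  obtain ⟨i, j, hij, hxij⟩ := hx
  have hnot : x ∉ tsupport (prodBumps ρ n c : (Fin n → EuclideanSpace ℝ (Fin 4)) → ℂ) := by
    intro hmem
    have h := tsupport_prodBumps_subset ρ hρ c hmem
    have hi := h i
    have hj := h j
    rw [Metric.mem_closedBall] at hi hj
    rw [hxij] at hi
    have := dist_triangle_left (c i) (c j) (x j)
    linarith [hc i j hij]
  exact image_eq_zero_of_notMem_tsupport (fun h => hnot (tsupport_iteratedFDeriv_subset k h))

/-- Diagonal translation of the centres is `translateMulti`. -/
theorem prodBumps_add_const (c : Fin n → EuclideanSpace ℝ (Fin 4)) (v : EuclideanSpace ℝ (Fin 4)) :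
    prodBumps ρ n (fun i => c i + v) = translateMulti v (prodBumps ρ n c) := by
  ext x
  simp only [prodBumps_apply, translateMulti_apply]
  exact Finset.prod_congr rfl fun i _ => by congr 1; abel

/-- A linear isometry leaving the profile invariant moves the centres. -/
theorem linActMulti_prodBumps (P : EuclideanSpace ℝ (Fin 4) ≃ₗᵢ[ℝ] EuclideanSpace ℝ (Fin 4))
    (hP : ∀ x, ρ (P.symm x) = ρ x) (c : Fin n → EuclideanSpace ℝ (Fin 4)) :
    linActMulti P (prodBumps ρ n c) = prodBumps ρ n (fun i => P (c i)) := by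
  ext x
  simp only [linActMulti_apply, prodBumps_apply]
  refine Finset.prod_congr rfl fun i _ => ?_
  have h1 : P.symm (x i) - c i = P.symm (x i - P (c i)) := by
    rw [map_sub, LinearIsometryEquiv.symm_apply_apply]
  rw [h1, hP]

/-- Permuting the points permutes the centres. -/
theorem permTest_prodBumps (π : Equiv.Perm (Fin n)) (c : Fin n → EuclideanSpace ℝ (Fin 4)) :
    permTest π (prodBumps ρ n c) = prodBumps ρ n (c ∘ π.symm) := by
  ext x
  simp only [permTest_apply, prodBumps_apply, Function.comp_apply]
  exact Fintype.prod_equiv π _ _ fun i => by simp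

/-! ### Time-ordering -/

/-- The time coordinate is `1`-Lipschitz: `|x⁰ − y⁰| ≤ dist x y`. -/
theorem abs_apply_zero_sub_le (x y : EuclideanSpace ℝ (Fin 4)) : |x 0 - y 0| ≤ dist x y := by
  rw [dist_eq_norm, ← PiLp.sub_apply]
  have := EuclideanSpace.norm_eq (x - y)
  calc |(x - y) 0| = Real.sqrt ((x - y) 0 ^ 2) := (Real.sqrt_sq_eq_abs _).symm
    _ ≤ ‖x - y‖ := by
        rw [EuclideanSpace.norm_eq]
        refine Real.sqrt_le_sqrt ?_
        have := Finset.single_le_sum (f := fun i : Fin 4 => ‖(x - y) i‖ ^ 2) (fun i _ => sq_nonneg _)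
          (Finset.mem_univ 0)
        simpa using this

/-- **Time-ordering of product bumps**: if the centres have times `> r` increasing with consecutive gaps `> 2r`, the
product bump (profile supported in the closed `r`-ball) is time-ordered. -/
theorem isTimeOrdered_prodBumps {r : ℝ} (hρ : tsupport (ρ : EuclideanSpace ℝ (Fin 4) → ℂ) ⊆ Metric.closedBall 0 r)
    {m : ℕ} {c : Fin m → EuclideanSpace ℝ (Fin 4)} (h0 : ∀ j, r < c j 0)
    (hgap : ∀ i j : Fin m, i < j → 2 * r < c j 0 - c i 0) : IsTimeOrdered (prodBumps ρ m c) := by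
  intro x hx
  have hx' := tsupport_prodBumps_subset ρ hρ c hx
  have hb : ∀ j, |x j 0 - c j 0| ≤ r := fun j => (abs_apply_zero_sub_le (x j) (c j)).trans (Metric.mem_closedBall.1 (hx' j))
  refine ⟨fun j => ?_, fun i j hij => ?_⟩
  · have := hb j; have := h0 j; rw [abs_le] at *; linarith
  · have h1 := hb i; have h2 := hb j; have h3 := hgap i j hij
    rw [abs_le] at h1 h2
    linarith

/-! ### The two-cluster identity -/

/-- **Two-cluster identity.**  For a profile that is real and invariant under the time reflection, the OS test
function `Θ X* ⊗ T_{t e₀} U` built from the product bumps `X = ⊗ⱼ ρ(· − θ c_L(rev j))` and `U = ⊗ⱼ ρ(· − c_U j)` is the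
product bump over the appended configuration `(c_L, c_U + t e₀)`. -/
theorem osAdjoint_prodBumps_appendTensor (hρθ : ∀ x, ρ (timeReflection 4 x) = ρ x) (hρre : ∀ x, conj (ρ x) = ρ x) {a b : ℕ} (cL : Fin a → EuclideanSpace ℝ (Fin 4)) (cU : Fin b → EuclideanSpace ℝ (Fin 4)) (t : ℝ) : (osAdjoint (prodBumps ρ a (fun j => timeReflection 4 (cL (Fin.rev j))))).appendTensor (translateMulti (timeVec t) (prodBumps ρ b cU)) = prodBumps ρ (a + b) (Fin.append cL (fun j => cU j + timeVec t)) := by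
  ext x
  rw [SchwartzMap.appendTensor_apply, osAdjoint_apply, translateMulti_apply, prodBumps_apply, prodBumps_apply,
    prodBumps_apply, Fin.prod_univ_add]
  congr 1
  · rw [map_prod]
    refine (Fintype.prod_equiv Fin.revPerm _ _ fun i => ?_)
    simp only [Fin.revPerm_apply, Function.comp_apply, Fin.append_left]
    rw [hρre, ← map_sub, hρθ]
  · refine Finset.prod_congr rfl fun j _ => ?_
    simp only [Fin.append_right, Function.comp_apply]
    congr 1
    abel

/-! ### The product-bump function of a one-field family -/

variable (S₁ : SchwingerFamily (EuclideanSpace ℝ (Fin 4)))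

/-- **`𝒰(c) = S₁ₙ(⊗ᵢ ρ(· − cᵢ))`**, the product-bump function of the family. -/
def bumpFn (n : ℕ) (c : Fin n → EuclideanSpace ℝ (Fin 4)) : ℂ := S₁ n (prodBumps ρ n c)

/-- Continuity of `𝒰` in the centres. -/
theorem continuous_bumpFn : Continuous (bumpFn ρ S₁ n) :=
  (S₁ n).continuous.comp (continuous_prodBumps ρ)

variable {ρ S₁}

/-- Translation invariance of `𝒰` (on separated configurations). -/
theorem bumpFn_add_const {r : ℝ} (hρ : tsupport (ρ : EuclideanSpace ℝ (Fin 4) → ℂ) ⊆ Metric.closedBall 0 r)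
    (htrans : ∀ (n : ℕ) (t : EuclideanSpace ℝ (Fin 4)) (F : 𝓢((Fin n → EuclideanSpace ℝ (Fin 4)), ℂ)),
      IsOffDiagonal F → S₁ n (translateMulti t F) = S₁ n F)
    {c : Fin n → EuclideanSpace ℝ (Fin 4)} (hc : SepCenters r c) (v : EuclideanSpace ℝ (Fin 4)) :
    bumpFn ρ S₁ n (fun i => c i + v) = bumpFn ρ S₁ n c := by
  rw [bumpFn, bumpFn, prodBumps_add_const, htrans _ _ _ (isOffDiagonal_prodBumps ρ hρ hc)]

/-- Invariance of `𝒰` under a linear isometry of the invariance class leaving the profile fixed. -/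
theorem bumpFn_isometry {r : ℝ} (hρ : tsupport (ρ : EuclideanSpace ℝ (Fin 4) → ℂ) ⊆ Metric.closedBall 0 r)
    {P : EuclideanSpace ℝ (Fin 4) ≃ₗᵢ[ℝ] EuclideanSpace ℝ (Fin 4)} (hP : ∀ x, ρ (P.symm x) = ρ x)
    (hinv : ∀ (n : ℕ) (F : 𝓢((Fin n → EuclideanSpace ℝ (Fin 4)), ℂ)), IsOffDiagonal F → S₁ n (linActMulti P F) = S₁ n F)
    {c : Fin n → EuclideanSpace ℝ (Fin 4)} (hc : SepCenters r c) :
    bumpFn ρ S₁ n (fun i => P (c i)) = bumpFn ρ S₁ n c := by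
  rw [bumpFn, bumpFn, ← linActMulti_prodBumps ρ P hP, hinv _ _ (isOffDiagonal_prodBumps ρ hρ hc)]

/-- E3: `𝒰` is invariant under permutations of the points (on separated configurations). -/
theorem bumpFn_comp_perm {r : ℝ} (hρ : tsupport (ρ : EuclideanSpace ℝ (Fin 4) → ℂ) ⊆ Metric.closedBall 0 r)
    (hE3 : S₁.toLabelled.IsSymmetric) {c : Fin n → EuclideanSpace ℝ (Fin 4)} (hc : SepCenters r c)
    (π : Equiv.Perm (Fin n)) : bumpFn ρ S₁ n (c ∘ π) = bumpFn ρ S₁ n c := by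
  have hsep : SepCenters r (c ∘ π) := fun i j hij => hc _ _ (fun h => hij (π.injective h))
  have h := hE3 n (fun _ => ()) π (prodBumps ρ n (c ∘ π)) (isOffDiagonal_prodBumps ρ hρ hsep)
  simp only [SchwingerFamily.toLabelled_apply] at h
  rw [permTest_prodBumps] at h
  have hc' : (c ∘ π) ∘ π.symm = c := by funext i; simp
  rw [hc'] at h
  rw [bumpFn, bumpFn, h]

end Summit.QuantumFields.YangMills.Theorems.OSLegsAtWeakCouplingC

end
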